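import Summits.AtomisticToContinuum.Crystallization.Theorems.ReggeStarCoercivityDefectFreeCrystallizesDevelopmentSteps1
import Summits.AtomisticToContinuum.Crystallization.Theorems.ReggeStarCoercivityDefectFreeCrystallizesDevelopmentSteps2
import Summits.AtomisticToContinuum.Crystallization.Theorems.ReggeStarCoercivityDefectFreeCrystallizesDevelopmentSteps3
import Summits.AtomisticToContinuum.Crystallization.Theorems.ReggeStarCoercivityDefectFreeCrystallizesDevelopmentComm1
import Summits.AtomisticToContinuum.Crystallization.Theorems.ReggeStarCoercivityDefectFreeCrystallizesDevelopmentGlobalA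
import Summits.AtomisticToContinuum.Crystallization.Theorems.ReggeStarCoercivityDefectFreeCrystallizesDevelopmentGlobalB
import Summits.AtomisticToContinuum.Crystallization.Theorems.ReggeStarCoercivityDefectFreeCrystallizesDevelopmentGlobalC
import Summits.AtomisticToContinuum.Crystallization.Theorems.ReggeStarCoercivityDefectFreeCrystallizesDevelopmentGlobalD
import Summits.AtomisticToContinuum.Crystallization.Theorems.ReggeStarCoercivityDefectFreeCrystallizesDevelopmentGlobalE
import Summits.AtomisticToContinuum.Crystallization.Theorems.PalmUnimodularRigidityShellsToBarlowChartTransportGlobalF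

/-!
# STAR and LINK at every frame of the development (port to the abstract `1/20` chart clauses)

Port of `Theorems/PalmUnimodularRigidityShellsToBarlowChartTransportGlobalF.lean` (crux 9227, line
`develop-the-model-growth-descent`) to the ABSTRACT chart clauses of line `palm-good-law` of crux
stmt-AtomisticToContinuum-13603 (stub R1a4 `stub_combinatorialDevelopment`): the integer-chart hypothesis
`hch : ∀ z ∈ S, IsZChart S z …` is replaced by the section hypothesis `hch` = (pattern `fcc3Int`/`hcpInt`,
labelling `nb z` bijective onto the bonded neighbours, exact links) at every site ∧ the transfer identity for
every bonded pair; statements and proofs are otherwise verbatim (the transports `Istep, …, frameAt` and the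
pattern facts `TransportPatterns*` are reused by name).  All `[folklore]` (HalesDSP2012 §1.3).
-/

noncomputable section

namespace Summit.AtomisticToContinuum.Crystallization.Theorems.PalmGoodLaw.Development

open Literature.Geometry.DiscreteGeometry Literature.MathematicalPhysics.StatisticalMechanics
open Summit.AtomisticToContinuum.Crystallization.Theorems.ShellsToBarlowChartNegative
open Summit.AtomisticToContinuum.Crystallization.Theorems.PalmUnimodularRigidityShellsToBarlowChart

variable {S : Set (EuclideanSpace ℝ (Fin 3))} {Pc : (EuclideanSpace ℝ (Fin 3)) → Finset (Fin 3 → ℤ)}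
  {nb : (EuclideanSpace ℝ (Fin 3)) → (Fin 3 → ℤ) → (EuclideanSpace ℝ (Fin 3))}
  (hch : (∀ z ∈ S, (Pc z = fcc3Int ∨ Pc z = hcpInt) ∧
      Set.BijOn (nb z) (↑(Pc z) : Set (Fin 3 → ℤ)) {y | y ∈ S ∧ (0 < dist z y ∧ dist z y ≤ 28 / 25)} ∧
      (∀ t ∈ Pc z, ∀ t' ∈ Pc z,
        ((0 < dist (nb z t) (nb z t') ∧ dist (nb z t) (nb z t') ≤ 28 / 25) ↔ sqNormInt (t - t') = 18))) ∧
    (∀ x ∈ S, ∀ y ∈ S, (0 < dist x y ∧ dist x y ≤ 28 / 25) →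
      ∀ (z z' : EuclideanSpace ℝ (Fin 3)) (t t' u u' : Fin 3 → ℤ),
        ((t = 0 ∧ z = x) ∨ (t ∈ Pc x ∧ z = nb x t)) → ((t' = 0 ∧ z' = x) ∨ (t' ∈ Pc x ∧ z' = nb x t')) →
        ((u = 0 ∧ z = y) ∨ (u ∈ Pc y ∧ z = nb y u)) → ((u' = 0 ∧ z' = y) ∨ (u' ∈ Pc y ∧ z' = nb y u')) →
        sqNormInt (u - u') = sqNormInt (t - t')))

include hch in
/-- **The twelve neighbour sites of a frame of the development, by label.**  For
`⟨x, t₁, t₂, U⟩ = frameAt g₀ k i j` with apexes `c` (upper cap) and `d` (lower cap): the sites at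
`(k, i±1, j)`, `(k, i, j±1)`, `(k, i∓1, j±1)`, `(k+1, ·)`, `(k−1, ·)` carry the expected labels.
[folklore] -/
theorem sites {g₀ : ZFrame}
    (h₀ : IsFrame (Pc g₀.pt) g₀.t₁ g₀.t₂ g₀.U) (h₀S : g₀.pt ∈ S) (h₀p : frameParity g₀.t₁ g₀.t₂ g₀.U = 1)
    (h₀A : (∀ z ∈ S, Pc z = fcc3Int) ∨ Pc g₀.pt = hcpInt) (k i j : ℤ) {x : (EuclideanSpace ℝ (Fin 3))} {t₁ t₂ : Fin 3 → ℤ}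
    {U : Finset (Fin 3 → ℤ)} (h : frameAt Pc nb g₀ k i j = ⟨x, t₁, t₂, U⟩) :
    (frameAt Pc nb g₀ k (i + 1) j).pt = nb x t₁ ∧ (frameAt Pc nb g₀ k (i - 1) j).pt = nb x (-t₁) ∧
    (frameAt Pc nb g₀ k i (j + 1)).pt = nb x t₂ ∧ (frameAt Pc nb g₀ k i (j - 1)).pt = nb x (-t₂) ∧
    (frameAt Pc nb g₀ k (i - 1) (j + 1)).pt = nb x (t₂ - t₁) ∧
    (frameAt Pc nb g₀ k (i + 1) (j - 1)).pt = nb x (t₁ - t₂) ∧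
    (frameAt Pc nb g₀ (k + 1) i j).pt = nb x (apexOf t₁ t₂ U) ∧
    (frameParity t₁ t₂ U = 1 → (frameAt Pc nb g₀ (k + 1) (i - 1) j).pt = nb x (apexOf t₁ t₂ U - t₁) ∧
      (frameAt Pc nb g₀ (k + 1) i (j - 1)).pt = nb x (apexOf t₁ t₂ U - t₂)) ∧
    (frameParity t₁ t₂ U = -1 → (frameAt Pc nb g₀ (k + 1) (i + 1) j).pt = nb x (apexOf t₁ t₂ U + t₁) ∧
      (frameAt Pc nb g₀ (k + 1) i (j + 1)).pt = nb x (apexOf t₁ t₂ U + t₂)) ∧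
    (frameAt Pc nb g₀ (k - 1) i j).pt = nb x (apexOf t₁ t₂ (lowerCap (Pc x) t₁ t₂ U)) ∧
    (lowerParity t₁ t₂ (lowerCap (Pc x) t₁ t₂ U) = 1 →
      (frameAt Pc nb g₀ (k - 1) (i + 1) j).pt = nb x (apexOf t₁ t₂ (lowerCap (Pc x) t₁ t₂ U) + t₁) ∧
      (frameAt Pc nb g₀ (k - 1) i (j + 1)).pt = nb x (apexOf t₁ t₂ (lowerCap (Pc x) t₁ t₂ U) + t₂)) ∧
    (lowerParity t₁ t₂ (lowerCap (Pc x) t₁ t₂ U) = -1 →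
      (frameAt Pc nb g₀ (k - 1) (i - 1) j).pt = nb x (apexOf t₁ t₂ (lowerCap (Pc x) t₁ t₂ U) - t₁) ∧
      (frameAt Pc nb g₀ (k - 1) i (j - 1)).pt = nb x (apexOf t₁ t₂ (lowerCap (Pc x) t₁ t₂ U) - t₂)) := by
  obtain ⟨hval, hS, hI, hJ, -, -⟩ := layers (Pc := Pc) (nb := nb) hch h₀ h₀S h₀p h₀A
  obtain ⟨e1, e2, e3, e4, e5, e6⟩ := sites_inlayer hch (hval k) (hS k) (hI k) (hJ k) i j h
  refine ⟨e1, e2, e3, e4, e5, e6, ?_⟩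
  -- upper part
  have hup : (frameAt Pc nb g₀ (k + 1) i j).pt = nb x (apexOf t₁ t₂ U) ∧
      (frameParity t₁ t₂ U = 1 → (frameAt Pc nb g₀ (k + 1) (i - 1) j).pt = nb x (apexOf t₁ t₂ U - t₁) ∧
        (frameAt Pc nb g₀ (k + 1) i (j - 1)).pt = nb x (apexOf t₁ t₂ U - t₂)) ∧
      (frameParity t₁ t₂ U = -1 → (frameAt Pc nb g₀ (k + 1) (i + 1) j).pt = nb x (apexOf t₁ t₂ U + t₁) ∧
        (frameAt Pc nb g₀ (k + 1) i (j + 1)).pt = nb x (apexOf t₁ t₂ U + t₂)) := by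
    rcases int_cases k with ⟨n, rfl⟩ | ⟨m, rfl⟩
    · have E := up_of_V hch (hval n) (hS n) (hI n) (hJ n) i j h
      simp only [frameAt_natSucc]
      exact E
    · have h' : VinvStep Pc nb (frameAt Pc nb g₀ (-(m : ℤ)) i j) = ⟨x, t₁, t₂, U⟩ := by
        rw [← frameAt_negSucc]; exact h
      have E := up_of_Vinv hch (hval (-(m : ℤ))) (hS (-(m : ℤ))) (hI (-(m : ℤ))) (hJ (-(m : ℤ))) i j h'
      rw [show -((m : ℤ) + 1) + 1 = -(m : ℤ) by ring]
      exact E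
  -- lower part
  have hdn : (frameAt Pc nb g₀ (k - 1) i j).pt = nb x (apexOf t₁ t₂ (lowerCap (Pc x) t₁ t₂ U)) ∧
      (lowerParity t₁ t₂ (lowerCap (Pc x) t₁ t₂ U) = 1 →
        (frameAt Pc nb g₀ (k - 1) (i + 1) j).pt = nb x (apexOf t₁ t₂ (lowerCap (Pc x) t₁ t₂ U) + t₁) ∧
        (frameAt Pc nb g₀ (k - 1) i (j + 1)).pt = nb x (apexOf t₁ t₂ (lowerCap (Pc x) t₁ t₂ U) + t₂)) ∧
      (lowerParity t₁ t₂ (lowerCap (Pc x) t₁ t₂ U) = -1 →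
        (frameAt Pc nb g₀ (k - 1) (i - 1) j).pt = nb x (apexOf t₁ t₂ (lowerCap (Pc x) t₁ t₂ U) - t₁) ∧
        (frameAt Pc nb g₀ (k - 1) i (j - 1)).pt = nb x (apexOf t₁ t₂ (lowerCap (Pc x) t₁ t₂ U) - t₂)) := by
    rcases int_cases' k with ⟨n, rfl⟩ | ⟨m, rfl⟩
    · have h' : Vstep Pc nb (frameAt Pc nb g₀ (n : ℤ) i j) = ⟨x, t₁, t₂, U⟩ := by
        rw [← frameAt_natSucc]; exact h
      have E := down_of_V hch (hval n) (hS n) (hI n) (hJ n) i j h'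
      rw [show (n : ℤ) + 1 - 1 = (n : ℤ) by ring]
      exact E
    · have E := down_of_Vinv hch (hval (-(m : ℤ))) (hS (-(m : ℤ))) (hI (-(m : ℤ))) (hJ (-(m : ℤ))) i j h
      rw [show -(m : ℤ) - 1 = -((m : ℤ) + 1) by ring]
      simp only [frameAt_negSucc]
      exact E
  exact ⟨hup.1, hup.2.1, hup.2.2, hdn.1, hdn.2.1, hdn.2.2⟩

include hch in
/-- Parity is constant along `I` and `J` in the development. [folklore] -/
theorem par_IJ {g₀ : ZFrame}
    (h₀ : IsFrame (Pc g₀.pt) g₀.t₁ g₀.t₂ g₀.U) (h₀S : g₀.pt ∈ S) (h₀p : frameParity g₀.t₁ g₀.t₂ g₀.U = 1)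
    (h₀A : (∀ z ∈ S, Pc z = fcc3Int) ∨ Pc g₀.pt = hcpInt) (k i j : ℤ) :
    frameParity (frameAt Pc nb g₀ k (i + 1) j).t₁ (frameAt Pc nb g₀ k (i + 1) j).t₂ (frameAt Pc nb g₀ k (i + 1) j).U =
      frameParity (frameAt Pc nb g₀ k i j).t₁ (frameAt Pc nb g₀ k i j).t₂ (frameAt Pc nb g₀ k i j).U ∧
    frameParity (frameAt Pc nb g₀ k i (j + 1)).t₁ (frameAt Pc nb g₀ k i (j + 1)).t₂ (frameAt Pc nb g₀ k i (j + 1)).U =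
      frameParity (frameAt Pc nb g₀ k i j).t₁ (frameAt Pc nb g₀ k i j).t₂ (frameAt Pc nb g₀ k i j).U := by
  obtain ⟨hval, hS, hI, hJ, -, -⟩ := layers (Pc := Pc) (nb := nb) hch h₀ h₀S h₀p h₀A
  rcases h : frameAt Pc nb g₀ k i j with ⟨x, t₁, t₂, U⟩
  obtain ⟨hx, hU, hIg, hJg, -⟩ := nbhd hch (hval k) (hS k) (hI k) (hJ k) i j h
  obtain ⟨-, -, -, -, -, -, -, -, -, -, -, -, hparI, -⟩ :=
    Istep_spec hch hx hU (hregI_of_valid (Pc := Pc) (nb := nb) hIg)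
  obtain ⟨-, -, -, -, -, -, -, -, -, -, -, -, hparJ, -⟩ :=
    Jstep_spec hch hx hU (hregJ_of_valid (Pc := Pc) (nb := nb) hJg)
  constructor
  · rw [hI k i j, h]; exact hparI
  · rw [hJ k i j, h]; exact hparJ

include hch in
/-- The letter read below a frame of the development is the parity of the frame one layer down.
[folklore] -/
theorem lowerParity_eq_par_below {g₀ : ZFrame}
    (h₀ : IsFrame (Pc g₀.pt) g₀.t₁ g₀.t₂ g₀.U) (h₀S : g₀.pt ∈ S) (h₀p : frameParity g₀.t₁ g₀.t₂ g₀.U = 1)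
    (h₀A : (∀ z ∈ S, Pc z = fcc3Int) ∨ Pc g₀.pt = hcpInt) (k i j : ℤ) :
    lowerParity (frameAt Pc nb g₀ k i j).t₁ (frameAt Pc nb g₀ k i j).t₂
        (lowerCap (Pc (frameAt Pc nb g₀ k i j).pt) (frameAt Pc nb g₀ k i j).t₁ (frameAt Pc nb g₀ k i j).t₂
          (frameAt Pc nb g₀ k i j).U) =
      frameParity (frameAt Pc nb g₀ (k - 1) i j).t₁ (frameAt Pc nb g₀ (k - 1) i j).t₂ (frameAt Pc nb g₀ (k - 1) i j).U := by
  obtain ⟨-, -, -, -, hupL, hdnL⟩ := layers (Pc := Pc) (nb := nb) hch h₀ h₀S h₀p h₀A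
  rcases int_cases' k with ⟨n, rfl⟩ | ⟨m, rfl⟩
  · rw [show (n : ℤ) + 1 - 1 = (n : ℤ) by ring]; exact hupL n i j
  · rw [show -(m : ℤ) - 1 = -((m : ℤ) + 1) by ring]; exact (hdnL m i j).symm

include hch in
/-- **STAR and LINK at every frame of the development.** [folklore] -/
theorem star_at {g₀ : ZFrame}
    (h₀ : IsFrame (Pc g₀.pt) g₀.t₁ g₀.t₂ g₀.U) (h₀S : g₀.pt ∈ S) (h₀p : frameParity g₀.t₁ g₀.t₂ g₀.U = 1)
    (h₀A : (∀ z ∈ S, Pc z = fcc3Int) ∨ Pc g₀.pt = hcpInt) (k i j : ℤ) {x : (EuclideanSpace ℝ (Fin 3))} {t₁ t₂ : Fin 3 → ℤ}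
    {U : Finset (Fin 3 → ℤ)} (h : frameAt Pc nb g₀ k i j = ⟨x, t₁, t₂, U⟩) {σm σp : ℤ}
    (hσp : frameParity t₁ t₂ U = σp) (hσm : lowerParity t₁ t₂ (lowerCap (Pc x) t₁ t₂ U) = σm) :
    Set.BijOn (fun y : ℤ × ℤ × ℤ => (frameAt Pc nb g₀ (k + y.1) (i - y.2.1) (j - y.2.2)).pt)
      (↑(linkOffsets σm σp) : Set (ℤ × ℤ × ℤ)) {z | z ∈ S ∧ (0 < dist x z ∧ dist x z ≤ 28 / 25)} ∧
    ∀ y ∈ linkOffsets σm σp, ∀ y' ∈ linkOffsets σm σp,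
      ((0 < dist (frameAt Pc nb g₀ (k + y.1) (i - y.2.1) (j - y.2.2)).pt
          (frameAt Pc nb g₀ (k + y'.1) (i - y'.2.1) (j - y'.2.2)).pt ∧
        dist (frameAt Pc nb g₀ (k + y.1) (i - y.2.1) (j - y.2.2)).pt
          (frameAt Pc nb g₀ (k + y'.1) (i - y'.2.1) (j - y'.2.2)).pt ≤ 28 / 25) ↔ linkAdj σm σp y y') := by
  obtain ⟨hval, hS, hI, hJ, -, -⟩ := layers (Pc := Pc) (nb := nb) hch h₀ h₀S h₀p h₀A
  have hx : x ∈ S := by have := hS k i j; rw [h] at this; exact this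
  have hU : IsFrame (Pc x) t₁ t₂ U := by have := hval k i j; rw [h] at this; exact this
  have hPx := pattern_cases hch hx
  obtain ⟨e1, e2, e3, e4, e5, e6, eU, eUp, eUm, eD, eDp, eDm⟩ := sites hch h₀ h₀S h₀p h₀A k i j h
  -- the label map and the site identities
  set c := apexOf t₁ t₂ U with hc
  set d := apexOf t₁ t₂ (lowerCap (Pc x) t₁ t₂ U) with hd
  have hΦ : ∀ y ∈ linkOffsets σm σp, (frameAt Pc nb g₀ (k + y.1) (i - y.2.1) (j - y.2.2)).pt =
      nb x ((if y.1 = 1 then c else if y.1 = -1 then d else 0) - y.2.1 • t₁ - y.2.2 • t₂) := by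
    intro y hy
    simp only [linkOffsets, Finset.mem_union, Finset.mem_image] at hy
    rcases hy with (⟨PQ, hPQ, rfl⟩ | ⟨PQ, hPQ, rfl⟩) | ⟨PQ, hPQ, rfl⟩
    · simp only [sixOffsets, Finset.mem_insert, Finset.mem_singleton] at hPQ
      rcases hPQ with rfl | rfl | rfl | rfl | rfl | rfl
      · norm_num; exact e2
      · norm_num; exact e1
      · norm_num; exact e4
      · norm_num; exact e3
      · norm_num; rw [e5]; congr 1; abel
      · norm_num; rw [e6]
    · -- upper layer: offsets `threeOffsets (−σp)`
      rcases frameParity_eq_or t₁ t₂ U with hp | hp <;> rw [← hσp, hp] at hPQ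
      · obtain ⟨f1, f2⟩ := eUp hp
        simp only [threeOffsets, Finset.mem_insert, Finset.mem_singleton, show ¬((-1 : ℤ) = 1) by decide,
          if_false] at hPQ
        rcases hPQ with rfl | rfl | rfl
        · norm_num; exact eU
        · norm_num; rw [f1]
        · norm_num; rw [f2]
      · obtain ⟨f1, f2⟩ := eUm hp
        simp only [threeOffsets, Finset.mem_insert, Finset.mem_singleton, neg_neg, if_true] at hPQ
        rcases hPQ with rfl | rfl | rfl
        · norm_num; exact eU
        · norm_num; rw [f1]
        · norm_num; rw [f2]
    · -- lower layer: offsets `threeOffsets σm`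
      rcases lowerParity_eq_or t₁ t₂ (lowerCap (Pc x) t₁ t₂ U) with hp | hp <;> rw [← hσm, hp] at hPQ
      · obtain ⟨f1, f2⟩ := eDp hp
        simp only [threeOffsets, Finset.mem_insert, Finset.mem_singleton, if_true] at hPQ
        rcases hPQ with rfl | rfl | rfl
        · norm_num; rw [show k + -1 = k - 1 by ring]; exact eD
        · norm_num; rw [show k + -1 = k - 1 by ring]; exact f1
        · norm_num; rw [show k + -1 = k - 1 by ring]; exact f2
      · obtain ⟨f1, f2⟩ := eDm hp
        simp only [threeOffsets, Finset.mem_insert, Finset.mem_singleton, show ¬((-1 : ℤ) = 1) by decide,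
          if_false] at hPQ
        rcases hPQ with rfl | rfl | rfl
        · norm_num; rw [show k + -1 = k - 1 by ring]; exact eD
        · norm_num; rw [show k + -1 = k - 1 by ring]; exact f1
        · norm_num; rw [show k + -1 = k - 1 by ring]; exact f2
  -- the table for the four letter patterns
  have hcardP : (Pc x).card = 12 := by
    rcases hPx with hP | hP <;> rw [hP] <;> decide
  rcases hPx with hP | hP
  · rcases frameParity_eq_or t₁ t₂ U with hp | hp
    · obtain ⟨hlp, hdd, himg, hrows⟩ := table_fcc_p hch hx hU hP hp
      have hσm' : σm = 1 := by rw [← hσm, hlp]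
      have hσp' : σp = 1 := by rw [← hσp, hp]
      subst hσm' hσp'
      rw [← hd, ← hc] at hdd
      rw [← hc, ← hdd] at himg hrows
      exact star_core hch hx _ himg hrows (card_linkOffsets 1 (by simp) 1 (by simp)) hcardP _ hΦ
    · obtain ⟨hlp, hdd, himg, hrows⟩ := table_fcc_m hch hx hU hP hp
      have hσm' : σm = -1 := by rw [← hσm, hlp]
      have hσp' : σp = -1 := by rw [← hσp, hp]
      subst hσm' hσp'
      rw [← hd, ← hc] at hdd
      rw [← hc, ← hdd] at himg hrows
      exact star_core hch hx _ himg hrows (card_linkOffsets (-1) (by simp) (-1) (by simp)) hcardP _ hΦ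
  · rcases frameParity_eq_or t₁ t₂ U with hp | hp
    · obtain ⟨hlp, hdd, himg, hrows⟩ := table_hcp_p hch hx hU hP hp
      have hσm' : σm = -1 := by rw [← hσm, hlp]
      have hσp' : σp = 1 := by rw [← hσp, hp]
      subst hσm' hσp'
      rw [← hd, ← hc] at hdd
      rw [← hc, ← hdd] at himg hrows
      exact star_core hch hx _ himg hrows (card_linkOffsets (-1) (by simp) 1 (by simp)) hcardP _ hΦ
    · obtain ⟨hlp, hdd, himg, hrows⟩ := table_hcp_m hch hx hU hP hp
      have hσm' : σm = 1 := by rw [← hσm, hlp]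
      have hσp' : σp = -1 := by rw [← hσp, hp]
      subst hσm' hσp'
      rw [← hd, ← hc] at hdd
      rw [← hc, ← hdd] at himg hrows
      exact star_core hch hx _ himg hrows (card_linkOffsets 1 (by simp) (-1) (by simp)) hcardP _ hΦ

/-- Landing anchor of this helper file (registered on crux stmt-AtomisticToContinuum-13603 for the port of stub R1a4;
a label of the integer kissing pattern). [folklore] -/
theorem development_globalf_anchor : ![-1, -4, -1] ∈ hcpInt := by decide

end Summit.AtomisticToContinuum.Crystallization.Theorems.PalmGoodLaw.Development

end
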